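import Summits.BirchSwinnertonDyer.BirchSwinnertonDyer.Theorems.ClassRecordThreeEulerHalvesAtThreeKolyvaginFamilyLineDefs
import Summits.BirchSwinnertonDyer.BirchSwinnertonDyer.Theorems.ClassRecordThreeEulerHalvesAtThreeKolyvaginRedefinition
import HarnessLib

/-!
# (P2) THE BOTTOM of a labelled family: at conductor `1` the transversal is all of `Gal(K[1]/K)`, the derived point is the
# image of `y ∈ E(K)` by the label (B2), and a non-torsion derived point has finite `p`-depth (`divOrd ≠ ⊤`, the walk's input
# `hdivfin`) — for the GENERALISED datum `JET.KolyvaginFamilyData W K ι n` (cell `bsd-stepL`, seat `bsd-stepL-tam3-p1` g12, owner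
# of 19109's line; `--supports stmt-BirchSwinnertonDyer-19109 --as helper`)

WHY (PORT MAP §2 (vi), RULING 46 (2)). In the `X₀(N)` walk, `hdivfin` (`Koly.divOrd_ne_top_of_levelIndex_eq_top`,
`…WalkSupplyAtThreeSharp`) reads the conductor-`1` derived point as the Heegner point `y_K` via Shimura reciprocity and gets its
non-torsion from Gross–Zagier; for a labelled CM family on `X_{N⁺,N⁻}` the same comes from the label (B2)
(`y ↦ Σ_{g ∈ Gal(K[1]/K)} g • ys 1`) and the non-torsion of `y` (the frame's `L′(E/K,1) ≠ 0` through (B1), as in corner3-p2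
g5's display). Contents: `mem_S_iff` (at conductor `1`, `S = Gal(K[1]/K)`; twin of `KolyvaginHeegnerData.mem_S_iff`),
`derivedPoint_eq_map_of_labelB2` (`P_1 = y` read in `E(K[1])`), `divOrd_ne_top_of_not_isOfFinAddOrder` (ANY conductor: a
non-torsion derived point of the finitely generated `E(K[n])` has an exact `p`-depth — tam3-p1 g10's
`exists_exactDepth_of_not_isOfFinAddOrder`, Krull), and the walk-shaped `divOrd_ne_top_of_levelIndex_eq_top` (`M(s) = ∞` forces
`s = 1`).

HONEST FRAMING: THEOREMS ONLY (no definition, no named fact, no `sorry`); the label (B2) and the non-torsion of `y` are HYPOTHESES;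
nothing about any curve; no item closes; BSD is not proved by any of this.
References: [cite: GrossLMS1991, §4 (4.1) (P_1 = Tr y_1 = y_K)] [cite: BertoliniDarmon1996, §2.5] [cite: McCallumLMS1991, §5 Lemma 5.1 (p. 303)]
[cite: WZhang2014, Notations (xii)]. presearch: not applicable (re-keying of tree theorems); `lean search 'KolyvaginFamilyData.mem_S_iff'` → none.
-/

set_option autoImplicit false

noncomputable section

open scoped Classical

universe u

namespace Summit.BirchSwinnertonDyer.Rank1Residual.JET.KolyvaginFamilyData

open WeierstrassCurve NumberField Literature.NumberTheory.EllipticCurves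
  Summit.BirchSwinnertonDyer.Rank1Residual.X11b.Three.Koly

variable {K : Type} [Field K] [NumberField K] {W : WeierstrassCurve ℚ} {ι : K →+* ℂ}

/-! ### §1 Conductor `1`: `S = Gal(K[1]/K)` and `P_1 = y` -/

/-- **At conductor `1` the transversal is forced: `S = 𝒢_1`** (`G_1 = Gal(K[1]/K[1])` is trivial, so every coset is a singleton);
twin of `KolyvaginHeegnerData.mem_S_iff`. [cite: GrossLMS1991, §4 (P_1 = Tr y_1 = y_K)] -/
theorem mem_S_iff (d : KolyvaginFamilyData W K ι 1)
    (g : ringClassField K ι 1 ≃ₐ[ℚ] ringClassField K ι 1) : g ∈ d.S ↔ g ∈ ringClassGal ι 1 := by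
  refine ⟨d.S_subset g, fun hg ↦ ?_⟩
  obtain ⟨s, ⟨hsS, hs⟩, -⟩ := d.S_transversal g hg
  -- `Gal(K[1]/K[1]) = ⊥`
  have hbot : g⁻¹ * s = 1 := by
    have hmem := hs
    rw [ringClassGalOver, mem_fixingSubgroup_iff] at hmem
    ext x
    exact congrArg Subtype.val (hmem x x.2)
  rw [inv_mul_eq_one] at hbot
  exact hbot ▸ hsS

/-- **`P_1 = y` in `E(K[1])` from the label (B2).** For a conductor-`1` family datum `d` with `d.y = ys 1` and the bottom-trace
label `y ↦ Σ_{g ∈ Gal(K[1]/K)} g • ys 1` (for every enumeration of `Gal(K[1]/K)`): `d.derivedPoint` is the image of `y ∈ E(K)`.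
[cite: GrossLMS1991, §4 (4.1)] [cite: BertoliniDarmon1996, §2.5] -/
theorem derivedPoint_eq_map_of_labelB2 (d : KolyvaginFamilyData W K ι 1)
    (ys1 : (W.baseChange (ringClassField K ι 1)).toAffine.Point) (hy : d.y = ys1)
    (y : (W.baseChange K).toAffine.Point)
    (hB2 : ∀ T : Finset (ringClassField K ι 1 ≃ₐ[ℚ] ringClassField K ι 1),
      (∀ g, g ∈ T ↔ g ∈ ringClassGal ι 1) →
      WeierstrassCurve.Affine.Point.map (W' := W) (algebraMap K (ringClassField K ι 1)).toRatAlgHom y =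
        ∑ g ∈ T, pointGalHom W (ringClassField K ι 1) g ys1) :
    d.derivedPoint = WeierstrassCurve.Affine.Point.map (W' := W) (algebraMap K (ringClassField K ι 1)).toRatAlgHom y := by
  rw [d.derivedPoint_one, hB2 d.S (d.mem_S_iff), hy]

/-! ### §2 Finite `p`-depth of a non-torsion derived point -/

/-- **A non-torsion derived point has finite `p`-depth** (`ord_p(P_n) < ∞`): `E(K[n])` is finitely generated (Mordell–Weil), and
an element of infinite order of a finitely generated abelian group has an exact `p`-depth (Krull; tam3-p1 g10's
`exists_exactDepth_of_not_isOfFinAddOrder`). Any conductor. [cite: McCallumLMS1991, §5 Lemma 5.1 (p. 303)] -/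
theorem divOrd_ne_top_of_not_isOfFinAddOrder {n : ℕ} [NumberField (ringClassField K ι n)] [W.IsElliptic]
    (d : KolyvaginFamilyData W K ι n) {p : ℕ} (hp : 1 < p) (hnt : ¬ IsOfFinAddOrder d.derivedPoint) :
    d.divOrd p ≠ ⊤ := by
  haveI : Module.Finite ℤ (W.baseChange (ringClassField K ι n)).toAffine.Point := by
    convert (W.baseChange (ringClassField K ι n)).module_finite_point_holds
  obtain ⟨u, -, hnd⟩ := exists_exactDepth_of_not_isOfFinAddOrder (p := p) hp hnt
  exact ne_top_of_le_ne_top (ENat.coe_ne_top u) (d.divOrd_le_of_not_pDiv p hnd)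

/-- **The walk's `hdivfin` for family data**: on the admissible-conductor subtype, `M(s) = ∞` forces `s = 1`, so it suffices that
the conductor-`1` data have non-torsion derived points (e.g. by `derivedPoint_eq_map_of_labelB2` and `y` non-torsion). Twin of the
first half of `Koly.divOrd_ne_top_of_levelIndex_eq_top`. [cite: WZhang2014, Notations (xii)] [cite: McCallumLMS1991, §5 Lemma 5.1] -/
theorem divOrd_ne_top_of_levelIndex_eq_top [NumberField (ringClassField K ι 1)] [W.IsElliptic] [W.IsGloballyMinimal]
    {N : ℕ} {p k : ℕ} (hp : 1 < p)
    (D : ∀ s : {m : ℕ // Squarefree m ∧ ∀ q ∈ m.primeFactors,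
        Zhang2014.IsKolyvaginPrime N W K p q ∧ k ≤ Zhang2014.kolyvaginIndex W p q},
      KolyvaginFamilyData W K ι s.1)
    (hbottom : ∀ s (hs : s.1 = 1), ¬ IsOfFinAddOrder (D s).derivedPoint)
    (s : {m : ℕ // Squarefree m ∧ ∀ q ∈ m.primeFactors,
      Zhang2014.IsKolyvaginPrime N W K p q ∧ k ≤ Zhang2014.kolyvaginIndex W p q})
    (hM : Zhang2014.levelIndex W p s.1 = ⊤) :
    (D s).divOrd p ≠ ⊤ := by
  -- `M(s) = ∞` forces `s = 1`
  have hs1 : s.1 = 1 := by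
    obtain ⟨m, hm⟩ := s
    have hempty : m.primeFactors = ∅ := by
      by_contra hne
      obtain ⟨q, hq⟩ := Finset.nonempty_iff_ne_empty.mpr hne
      have hle : Zhang2014.levelIndex W p m ≤ (Zhang2014.kolyvaginIndex W p q : ℕ∞) :=
        Finset.inf_le hq
      rw [hM, top_le_iff] at hle
      exact ENat.coe_ne_top _ hle
    rcases Nat.primeFactors_eq_empty.mp hempty with h0 | h1
    · exact absurd h0 hm.1.ne_zero
    · exact h1
  -- transport the instance `NumberField (K[s]) = NumberField (K[1])` along `s = 1` and conclude
  obtain ⟨m, hm⟩ := s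
  simp only at hs1
  subst hs1
  exact divOrd_ne_top_of_not_isOfFinAddOrder (D ⟨1, hm⟩) hp (hbottom ⟨1, hm⟩ rfl)

end Summit.BirchSwinnertonDyer.Rank1Residual.JET.KolyvaginFamilyData

end
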